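import Summits.BirchSwinnertonDyer.BirchSwinnertonDyer.Theorems.PrintCf2RamifiedOffTYZGenusPeriodDescentR2
import Summits.BirchSwinnertonDyer.BirchSwinnertonDyer.Theorems.PrintCf2RamifiedOffTYZGeneratorDescent
import HarnessLib

/-!
# THE GENUS PERIOD `Z(lm)` IS NOT TORSION on every two-prime row with `ord_{s=1} L(E_{lm}, s) = 1` — the hypothesis «`2·Z(n) ≠ 0`» of the
# exact-descent criterion DISCHARGED BY NAME (crux stmt-BirchSwinnertonDyer-20509 `RamifiedOffTYZOfFacts`, line `offtyz-v7`, LEAD g30, cycle 31, part B2)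

HONEST FRAMING (cell `bsd-print-cf2`, route `PrintCf2`; `--supports stmt-BirchSwinnertonDyer-20509`; theorems only, `def`-free, no `sorry`, no named
fact introduced).  BSD is not proved by any of this; no class is closed by this file; item 23431 (C⁺) and crux 20509 stay OPEN.

g29's criterion `GenusPeriodTraceNorm.levelTwo_iff_not_torsion_and_secondNorm_of_visible_R2_of_facts` (p801252) reads, on a visible R2 row:
«THEOREM A ∧ `ζ₈ ∉ ℍ′_n` ⟹ (C⁺ at `lq` ⟺ `2·Z(lq) ≠ 0` ∧ `N₀ ∉ ⟨i⟩ℍ′²`)».  Part B1 (`…ZetaEight`) discharged `ζ₈ ∉ ℍ′_n`.  THIS FILE proves that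
**`Z(lm)` is NOT a torsion point** — in particular `2·Z(lm) ≠ 0` — on EVERY two-prime row `n = lm` (`l ≡ 1 (mod 8)`, `m ≡ 5` or `7 (mod 8)` primes) with
`ord_{s=1} L(E_n, s) = 1`, granted GZK (conjunct 1), TYZ Thm 1.2′ (conjunct 5: `𝓛(m)` odd) and the displays `Printed` + Thm 3.5 at the block `m`:

* the recursion is EXACT on the sector: `P(lm) = Z(lm) − s·𝓛(l)·Z(m)`, `P(m) = Z(m)` (`LevelTwoTwoPrimes.P_eq_of_two_primes`);
* Thm 3.5 at `lm`: `2^{ρ+1}·P(lm) − s₁·𝓛(lm)·α_{lm}` is torsion, `α_{lm}` a NON-torsion generator of the free part of `A(K_{lm})⁻` (GZK,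
  `LevelTwo.exists_generatesFreePart_not_isOfFinAddOrder`), `𝓛(lm) ≠ 0` (`ord L = 1`, the P2 door); Thm 3.5 at the block `m`:
  `2·Z(m) − u·𝓛(m)·α_m` is torsion (`TwoPrimesByName.exists_h35_prime`);
* so IF `Z(lm)` were torsion, `s₁𝓛(lm)·α_{lm} + c·α_m` would be torsion for an integer `c` (§1, `isOfFinAddOrder_comb_of_torsion_genusPeriod`);
* ONE automorphism `g` of `ℍ′_n` with `g(√−m) = √−m`, `g(√−lm) = −√−lm` exists (§2 `exists_algEquiv_fix_flip`: otherwise `√−lm` or `√−lm·√−m = m√l`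
  would be fixed by `Gal(ℍ′_n/ℚ)`, i.e. rational); it FIXES the image of `α_m ∈ A(K_m)` and NEGATES the image of `α_{lm} ∈ A(K_{lm})⁻`, so applying
  `g` and subtracting gives `2s₁𝓛(lm)·α_{lm}` torsion — contradiction (§1 `false_of_flip_fix`).

Results: ★★ `genusPeriod_not_isOfFinAddOrder_two_primes` (`¬ IsOfFinAddOrder (D.Z n)`), `two_nsmul_genusPeriod_ne_zero` (the binder of the R2
criterion, `(2 : ℕ) • D.Z n ≠ 0`), and `genusPeriod_ne_zero`.  No hypothesis on `(l/m)`, Selmer groups, `ρ`, visibility or the partner.  (The prime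
level is the same argument without `g`: `Z(q) = P(q)` and `2·P(q) ∼ 𝓛(q)·α_q`, recorded as `genusPeriod_not_isOfFinAddOrder_prime`.)

References: [cite: TianYuanZhang2017, §3.1 (arXiv:1411.4728 chunk p0011 L27–L36, L53–L73), Thm. 3.5 (p0011 L94–L100), Thm. 1.2]; [cite: Darmon2004, Thm. 3.22]
(GZK); [cite: Lang2002, VI §1 Thm. 1.2] (fixed field of the Galois group); tree: `…LevelTwoTwoPrimes` (p-landed recursion), `…TwoPrimesByName`,
`…LevelTwoGenusPoint`, `…GeneratorDescent` (`algHom_comp_embK_eq_comp_conj`), `Rank1Residual/P2/CongruentNumberLevelTwoDoor`.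
-/

noncomputable section

open scoped Classical

open WeierstrassCurve WeierstrassCurve.Affine WeierstrassCurve.Affine.Point
  Literature.NumberTheory.EllipticCurves Literature.NumberTheory.EllipticCurves.Rank1Residual
  Summit.BirchSwinnertonDyer.Rank1Residual
  Literature.NumberTheory.EllipticCurves.TianYuanZhang2017
  Literature.NumberTheory.EllipticCurves.TianYuanZhang2017.W2

set_option autoImplicit false

namespace Summit.BirchSwinnertonDyer.PrintCf2.GenusPeriodNonTorsion

/-! ## §1 Layer A: two abstract lemmas on torsion relations -/

section Abstract

variable {G : Type*} [AddCommGroup G]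

/-- **Flip/fix lemma.**  If an additive endomorphism `f` negates `αn`, fixes `αm`, `αn` is non-torsion and `k ≠ 0`, then `k·αn + c·αm` is NOT
torsion: applying `f` and subtracting would make `2k·αn` torsion. [folklore] -/
theorem false_of_flip_fix (f : G →+ G) {αn αm : G} (hfn : f αn = -αn) (hfm : f αm = αm) (hαn : ¬ IsOfFinAddOrder αn)
    {k c : ℤ} (hk : k ≠ 0) (h : IsOfFinAddOrder (k • αn + c • αm)) : False := by
  have h2 : IsOfFinAddOrder (f (k • αn + c • αm)) := f.isOfFinAddOrder h
  rw [map_add, map_zsmul, map_zsmul, hfn, hfm] at h2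
  have h3 : IsOfFinAddOrder ((k • αn + c • αm) + -(k • -αn + c • αm)) := h.add h2.neg
  have e : (k • αn + c • αm) + -(k • -αn + c • αm) = (2 * k) • αn := by module
  rw [e] at h3
  exact hαn (LevelTwo.isOfFinAddOrder_of_zsmul (mul_ne_zero two_ne_zero hk) h3)

/-- **The torsion combination.**  From Thm 3.5 at `n` (`2^{ρ+1}·P − k·αn` torsion), the exact recursion `P = Z − s·(Lₗ·Zm)`, Thm 3.5 at the block
(`2·Zm − v·αm` torsion) and «`Z` torsion»: `k·αn + (s·Lₗ·2^ρ·v)·αm` is torsion. [cite: TianYuanZhang2017, §3.1 (p0011 L67–L73), Thm. 3.5 (p0011 L94–L100)] -/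
theorem isOfFinAddOrder_comb_of_torsion_genusPeriod {P Z Zm αn αm : G} {ρ : ℕ} {k s Ll v : ℤ}
    (h35n : IsOfFinAddOrder (((2 : ℤ) ^ (ρ + 1)) • P - k • αn)) (hP : P = Z - s • (Ll • Zm))
    (h35m : IsOfFinAddOrder ((2 : ℤ) • Zm - v • αm)) (hZ : IsOfFinAddOrder Z) :
    IsOfFinAddOrder (k • αn + (s * Ll * 2 ^ ρ * v) • αm) := by
  have e : k • αn + (s * Ll * 2 ^ ρ * v) • αm =
      ((2 : ℤ) ^ (ρ + 1)) • Z + -((s * Ll * 2 ^ ρ) • ((2 : ℤ) • Zm - v • αm)) + -(((2 : ℤ) ^ (ρ + 1)) • P - k • αn) := by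
    rw [hP]
    module
  rw [e]
  exact (hZ.zsmul.add h35m.zsmul.neg).add h35n.neg

end Abstract

/-! ## §2 Galois preliminaries: `g ∘ ι_d = ι_d` when `g` fixes `√−d`; an automorphism fixing `√−m` and negating `√−lm` -/

section Galois

variable {n : ℕ}

/-- If `g(√−d) = √−d` then `g ∘ ι_d = ι_d` for the embedding `ι_d : K_d → ℍ′_n`, ANY divisor `d` of `n` (the tree's `GaloisMotion.algHom_comp_embK_eq`
is the case `d = n`). [cite: TianYuanZhang2017, §3.1 (p0011 L60–L64)] -/
theorem algHom_comp_embK_eq_of_fix (D : GenusPointData n) {d : ℕ} (hd : d ∈ n.divisors) (g : D.H ≃ₐ[ℚ] D.H)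
    (hg : g (D.sqrtNeg d) = D.sqrtNeg d) :
    (g : D.H →ₐ[ℚ] D.H).comp (D.embK d hd) = D.embK d hd := by
  apply AdjoinRoot.algHom_ext
  have h1 : (D.embK d hd) (AdjoinRoot.root (genusFieldPoly d)) = D.sqrtNeg d := AdjoinRoot.liftAlgHom_root _ _ _ _
  show g ((D.embK d hd) (AdjoinRoot.root (genusFieldPoly d))) = (D.embK d hd) (AdjoinRoot.root (genusFieldPoly d))
  rw [h1, hg]

/-- `g` FIXES the image in `A(ℍ′_n)` of a `K_d`-point when `g(√−d) = √−d`. [cite: TianYuanZhang2017, §3.1 (p0011 L27–L36)] -/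
theorem galPt_map_embK_of_fix (D : GenusPointData n) {d : ℕ} (hd : d ∈ n.divisors) (g : D.H ≃ₐ[ℚ] D.H)
    (hg : g (D.sqrtNeg d) = D.sqrtNeg d) (β : APoint (GenusField d)) :
    D.galPt g (Point.map (W' := curveA) (D.embK d hd) β) = Point.map (W' := curveA) (D.embK d hd) β := by
  change Point.map (W' := curveA) (g : D.H →ₐ[ℚ] D.H) _ = _
  rw [Point.map_map, algHom_comp_embK_eq_of_fix D hd g hg]

/-- `g` NEGATES the image in `A(ℍ′_n)` of a point of `A(K_n)⁻` when `g(√−n) = −√−n`. [cite: TianYuanZhang2017, §3.1 (p0011 L27–L36)] -/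
theorem galPt_map_embK_of_flip_of_mem_minusPart (D : GenusPointData n) (hn : n ∈ n.divisors) (g : D.H ≃ₐ[ℚ] D.H)
    (hg : g (D.sqrtNeg n) = -D.sqrtNeg n) {α : APoint (GenusField n)} (hα : α ∈ minusPart n) :
    D.galPt g (Point.map (W' := curveA) (D.embK n hn) α) = -Point.map (W' := curveA) (D.embK n hn) α := by
  change Point.map (W' := curveA) (g : D.H →ₐ[ℚ] D.H) _ = _
  rw [Point.map_map, GeneratorDepth.algHom_comp_embK_eq_comp_conj D hn g hg, ← Point.map_map]
  rw [show Point.map (W' := curveA) (genusFieldConj n) α = -α from hα, map_neg]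

/-- A prime is not the square of a rational number. [folklore] -/
private theorem not_sq_eq_prime {p : ℕ} (hp : p.Prime) (q : ℚ) : q ^ 2 ≠ (p : ℚ) := by
  intro h
  have hsqQ : IsSquare (p : ℚ) := ⟨q, by rw [← h, sq]⟩
  obtain ⟨m, hm⟩ := Rat.isSquare_natCast_iff.1 hsqQ
  have hmu : IsUnit m := hp.squarefree m ⟨1, by rw [mul_one]; exact hm⟩
  rw [Nat.isUnit_iff] at hmu
  subst hmu
  exact hp.one_lt.ne' (by simpa using hm)

/-- **An automorphism of `ℍ′_{lm}` fixing `√−m` and negating `√−lm` exists** (`l ≠ m` primes): otherwise every automorphism flipping `√−lm`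
flips `√−m`, and then either `√−lm` is fixed by all of `Gal(ℍ′_n/ℚ)` (so `−lm` is a rational square) or `√−lm·√−m` is (so `l·m² `, hence `l`, is a
rational square). [cite: TianYuanZhang2017, §3.1 (p0011 L60–L64)] [cite: Lang2002, VI §1 Thm. 1.2] -/
theorem exists_algEquiv_fix_flip {l m : ℕ} (hl : l.Prime) (hm : m.Prime) (hn : n = l * m) (D : GenusPointData n) :
    ∃ g : D.H ≃ₐ[ℚ] D.H, g (D.sqrtNeg m) = D.sqrtNeg m ∧ g (D.sqrtNeg n) = -D.sqrtNeg n := by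
  have hn0 : n ≠ 0 := by rw [hn]; exact Nat.mul_ne_zero hl.ne_zero hm.ne_zero
  have hnd : n ∈ n.divisors := Nat.mem_divisors_self n hn0
  have hmd : m ∈ n.divisors := Nat.mem_divisors.mpr ⟨hn ▸ Dvd.intro_left l rfl, hn0⟩
  have hinj : Function.Injective (algebraMap ℚ D.H) := (algebraMap ℚ D.H).injective
  by_contra hne
  push Not at hne
  -- every `g` flipping `√−n` flips `√−m`
  have hflip : ∀ g : D.H ≃ₐ[ℚ] D.H, g (D.sqrtNeg n) = -D.sqrtNeg n → g (D.sqrtNeg m) = -D.sqrtNeg m := fun g hg =>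
    (GenusPointData.algEquiv_sqrtNeg_eq_or D hmd g).resolve_left fun hfix => hne g hfix hg
  by_cases hall : ∀ g : D.H ≃ₐ[ℚ] D.H, g (D.sqrtNeg n) = D.sqrtNeg n
  · -- `√−n` is rational: impossible (`−n < 0`)
    obtain ⟨q, hq⟩ := (IsGalois.mem_range_algebraMap_iff_fixed (D.sqrtNeg n)).mpr hall
    have hq2 : q ^ 2 = -(n : ℚ) := hinj (by rw [map_pow, hq, D.sqrtNeg_sq n hnd, map_neg, map_natCast])
    have hnpos : (0 : ℚ) < n := by exact_mod_cast Nat.pos_of_ne_zero hn0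
    nlinarith [sq_nonneg q]
  · push Not at hall
    obtain ⟨g₁, hg₁⟩ := hall
    have hg₁n : g₁ (D.sqrtNeg n) = -D.sqrtNeg n := (GenusPointData.algEquiv_sqrtNeg_eq_or D hnd g₁).resolve_left hg₁
    have hg₁m : g₁ (D.sqrtNeg m) = -D.sqrtNeg m := hflip g₁ hg₁n
    -- then `w = √−n · √−m` is fixed by every automorphism
    have hw : ∀ g : D.H ≃ₐ[ℚ] D.H, g (D.sqrtNeg n * D.sqrtNeg m) = D.sqrtNeg n * D.sqrtNeg m := by
      intro g
      rcases GenusPointData.algEquiv_sqrtNeg_eq_or D hnd g with hgn | hgn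
      · -- `g` fixes `√−n`; if it flipped `√−m`, `g₁ g` would fix `√−m` and flip `√−n`
        have hgm : g (D.sqrtNeg m) = D.sqrtNeg m := by
          by_contra hgm
          have hgm' : g (D.sqrtNeg m) = -D.sqrtNeg m := (GenusPointData.algEquiv_sqrtNeg_eq_or D hmd g).resolve_left hgm
          have h1 : (g₁ * g) (D.sqrtNeg m) = D.sqrtNeg m := by rw [AlgEquiv.mul_apply, hgm', map_neg, hg₁m, neg_neg]
          have h2 : (g₁ * g) (D.sqrtNeg n) = -D.sqrtNeg n := by rw [AlgEquiv.mul_apply, hgn, hg₁n]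
          exact hne _ h1 h2
        rw [map_mul, hgn, hgm]
      · rw [map_mul, hgn, hflip g hgn]; ring
    obtain ⟨q, hq⟩ := (IsGalois.mem_range_algebraMap_iff_fixed (D.sqrtNeg n * D.sqrtNeg m)).mpr hw
    have hq2 : q ^ 2 = (n : ℚ) * m := hinj (by
      rw [map_pow, hq, mul_pow, D.sqrtNeg_sq n hnd, D.sqrtNeg_sq m hmd, map_mul, map_natCast, map_natCast]; ring)
    have hm0 : (m : ℚ) ≠ 0 := by exact_mod_cast hm.ne_zero
    apply not_sq_eq_prime hl (q / m)
    rw [div_pow, hq2, hn]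
    push_cast
    field_simp

end Galois

/-! ## §3 `Z(lm)` is not torsion -/

section Main

variable {n : ℕ}

/-- The two-prime sector is square-free, odd or `≡ 5, 6, 7`-admissible: `n = lm ≡ m (mod 8)`. [folklore] -/
theorem squarefree_and_mod_two_primes {l m : ℕ} (hl : l.Prime) (hm : m.Prime) (hl8 : l % 8 = 1) (hm8 : m % 8 = 5 ∨ m % 8 = 7)
    (hn : n = l * m) : Squarefree n ∧ (n % 8 = 5 ∨ n % 8 = 6 ∨ n % 8 = 7) ∧ 1 < n := by
  have hne : l ≠ m := fun h => by subst h; omega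
  refine ⟨?_, ?_, ?_⟩
  · rw [hn]; exact Nat.squarefree_mul_iff.mpr ⟨(Nat.coprime_primes hl hm).mpr hne, hl.squarefree, hm.squarefree⟩
  · rw [hn, LevelTwoTwoPrimes.mul_mod_eight_of_one hl8]; rcases hm8 with h | h
    · exact Or.inl h
    · exact Or.inr (Or.inr h)
  · rw [hn]; exact lt_of_lt_of_le hl.one_lt (Nat.le_mul_of_pos_right l hm.pos)

/-- ★★ **THE GENUS PERIOD `Z(lm)` IS NOT TORSION.**  Granted GZK (conjunct 1) and TYZ Thm 1.2′ (conjunct 5); primes `l ≡ 1 (mod 8)`, `m ≡ 5` or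
`7 (mod 8)`, `n = lm` with `ord_{s=1} L(E_n, s) = 1`; a package `D` with `Printed` and Thm 3.5 at the blocks.  Then `Z(n) ∈ A(ℍ′_n)` has infinite order.
[cite: TianYuanZhang2017, §3.1 (p0011 L27–L36, L53–L73), Thm. 3.5 (p0011 L94–L100), Thm. 1.2] [cite: Darmon2004, Thm. 3.22] [cite: Lang2002, VI §1 Thm. 1.2] -/
theorem genusPeriod_not_isOfFinAddOrder_two_primes (hGZK : rank_eq_analyticRank_of_analyticRank_le_one) (h12 : thm12_parity_of_scriptL')
    {l m : ℕ} (hl : l.Prime) (hm : m.Prime) (hl8 : l % 8 = 1) (hm8 : m % 8 = 5 ∨ m % 8 = 7) (hn : n = l * m)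
    (hr : (congruentNumberCurve n).analyticRank = 1)
    (D : GenusPointData n) (hPr : D.Printed) (hBl : D.Thm35AtBlocks) : ¬ IsOfFinAddOrder (D.Z n) := by
  intro hZ
  obtain ⟨hsq, h8, hn1⟩ := squarefree_and_mod_two_primes hl hm hl8 hm8 hn
  haveI := isElliptic_congruentNumberCurve hsq.ne_zero
  have hnd : n ∈ n.divisors := Nat.mem_divisors_self n hsq.ne_zero
  have hmd : m ∈ n.divisors := TwoPrimesByName.right_mem_divisors hl hm hn
  -- `𝓛(n) ≠ 0`
  have hL : IsScriptL n (D.scriptL n) := hPr.1 n hnd hn1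
  have hL0 : D.scriptL n ≠ 0 := (P2.bsdp_two_congruentNumberCurve_iff_of_isScriptL hGZK hsq hr hL).2.2.1
  -- the non-torsion generator at `n` and Thm 3.5's main clause at `n`
  obtain ⟨α, hα, hαnt⟩ := LevelTwo.exists_generatesFreePart_not_isOfFinAddOrder hGZK hsq hr
  obtain ⟨ρ, hρ⟩ := stub_S3 hsq
  obtain ⟨s₁, hs₁, h35n⟩ := ((hPr.2.2.2.2.1 hnd ρ hρ).2 hL0) α hα
  -- the block `m`: generator, Thm 3.5 at `m`, and the exact recursion
  obtain ⟨αm, hαm, -⟩ := TwoPrimesByName.exists_generatesFreePart_prime hGZK h12 hm hm8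
  obtain ⟨u, -, h35m⟩ := TwoPrimesByName.exists_h35_prime h12 hl hm hm8 hn D hPr.1 hBl αm hαm
  obtain ⟨hPm, s₂, -, hP⟩ := LevelTwoTwoPrimes.P_eq_of_two_primes hl hm hl8 hm8 hn D hPr.2.2.1 hPr.2.1
  rw [hPm] at h35m
  -- the torsion combination
  have hrel := isOfFinAddOrder_comb_of_torsion_genusPeriod h35n hP h35m hZ
  -- the automorphism fixing `√−m` and flipping `√−n`
  obtain ⟨g, hgm, hgn⟩ := exists_algEquiv_fix_flip hl hm hn D
  have hfn := galPt_map_embK_of_flip_of_mem_minusPart D hnd g hgn hα.1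
  have hfm := galPt_map_embK_of_fix D hmd g hgm αm
  have hαnt' : ¬ IsOfFinAddOrder (Point.map (W' := curveA) (D.embK n hnd) α) :=
    fun h => hαnt (LevelTwo.isOfFinAddOrder_of_map (D.embK n hnd) h)
  have hk : s₁ * D.scriptL n ≠ 0 := by
    refine mul_ne_zero ?_ hL0
    rcases hs₁ with rfl | rfl <;> norm_num
  exact false_of_flip_fix (D.galPt g) hfn hfm hαnt' hk hrel

/-- ★ **`2·Z(lm) ≠ 0`** — the binder of the R2 criterion (`GenusPeriodTraceNorm.levelTwo_iff_not_torsion_and_secondNorm_of_visible_R2_of_facts`),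
same hypotheses. [cite: TianYuanZhang2017, §3.1 (p0011 L53–L73), Thm. 3.5 (p0011 L94–L100)] [cite: Darmon2004, Thm. 3.22] -/
theorem two_nsmul_genusPeriod_ne_zero (hGZK : rank_eq_analyticRank_of_analyticRank_le_one) (h12 : thm12_parity_of_scriptL')
    {l m : ℕ} (hl : l.Prime) (hm : m.Prime) (hl8 : l % 8 = 1) (hm8 : m % 8 = 5 ∨ m % 8 = 7) (hn : n = l * m)
    (hr : (congruentNumberCurve n).analyticRank = 1)
    (D : GenusPointData n) (hPr : D.Printed) (hBl : D.Thm35AtBlocks) : (2 : ℕ) • D.Z n ≠ 0 := fun h2 =>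
  genusPeriod_not_isOfFinAddOrder_two_primes hGZK h12 hl hm hl8 hm8 hn hr D hPr hBl
    (isOfFinAddOrder_iff_nsmul_eq_zero.mpr ⟨2, two_pos, h2⟩)

/-- `Z(lm) ≠ 0`, same hypotheses. [cite: TianYuanZhang2017, §3.1 (p0011 L53–L73), Thm. 3.5 (p0011 L94–L100)] -/
theorem genusPeriod_ne_zero (hGZK : rank_eq_analyticRank_of_analyticRank_le_one) (h12 : thm12_parity_of_scriptL')
    {l m : ℕ} (hl : l.Prime) (hm : m.Prime) (hl8 : l % 8 = 1) (hm8 : m % 8 = 5 ∨ m % 8 = 7) (hn : n = l * m)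
    (hr : (congruentNumberCurve n).analyticRank = 1)
    (D : GenusPointData n) (hPr : D.Printed) (hBl : D.Thm35AtBlocks) : D.Z n ≠ 0 := fun h0 =>
  genusPeriod_not_isOfFinAddOrder_two_primes hGZK h12 hl hm hl8 hm8 hn hr D hPr hBl (by rw [h0]; exact IsOfFinAddOrder.zero)

/-- `Z(lm) ∉ A(ℍ′_n)_tor + 2^k·y`-type reformulation used by the depth language: «`Z(lm) − 2^k·0` torsion» fails, i.e. the depth statements about
`Z(lm)` are statements about a point of infinite order. [cite: TianYuanZhang2017, §3.1 (p0011 L53–L73)] -/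
theorem not_isOfFinAddOrder_genusPeriod_sub_zsmul_zero (hGZK : rank_eq_analyticRank_of_analyticRank_le_one) (h12 : thm12_parity_of_scriptL')
    {l m : ℕ} (hl : l.Prime) (hm : m.Prime) (hl8 : l % 8 = 1) (hm8 : m % 8 = 5 ∨ m % 8 = 7) (hn : n = l * m)
    (hr : (congruentNumberCurve n).analyticRank = 1)
    (D : GenusPointData n) (hPr : D.Printed) (hBl : D.Thm35AtBlocks) (k : ℤ) :
    ¬ IsOfFinAddOrder (D.Z n - k • (0 : APoint D.H)) := by
  rw [smul_zero, sub_zero]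
  exact genusPeriod_not_isOfFinAddOrder_two_primes hGZK h12 hl hm hl8 hm8 hn hr D hPr hBl

/-! ### The prime level (no Galois element needed): `Z(q) = P(q)` is not torsion -/

/-- **`Z(q)` is not torsion for a prime `q ≡ 5, 7 (mod 8)`** read in any package of an `n = l·q` (`l ≡ 1 (mod 8)` prime): `Z(q) = P(q)` and
`2·P(q) − u·𝓛(q)·α_q` is torsion with `𝓛(q)` odd and `α_q` non-torsion (GZK at `q`, `ord L(E_q) = 1` by conjunct 5).
[cite: TianYuanZhang2017, §3.1 (p0011 L67–L73), Thm. 3.5 (p0011 L94–L100), Thm. 1.2] [cite: Darmon2004, Thm. 3.22] -/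
theorem genusPeriod_not_isOfFinAddOrder_prime (hGZK : rank_eq_analyticRank_of_analyticRank_le_one) (h12 : thm12_parity_of_scriptL')
    {l m : ℕ} (hl : l.Prime) (hm : m.Prime) (hl8 : l % 8 = 1) (hm8 : m % 8 = 5 ∨ m % 8 = 7) (hn : n = l * m)
    (D : GenusPointData n) (hPr : D.Printed) (hBl : D.Thm35AtBlocks) : ¬ IsOfFinAddOrder (D.Z m) := by
  intro hZ
  have hmd : m ∈ n.divisors := TwoPrimesByName.right_mem_divisors hl hm hn
  obtain ⟨αm, hαm, hαmnt⟩ := TwoPrimesByName.exists_generatesFreePart_prime hGZK h12 hm hm8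
  obtain ⟨u, hu, h35m⟩ := TwoPrimesByName.exists_h35_prime h12 hl hm hm8 hn D hPr.1 hBl αm hαm
  obtain ⟨hPm, -⟩ := LevelTwoTwoPrimes.P_eq_of_two_primes hl hm hl8 hm8 hn D hPr.2.2.1 hPr.2.1
  rw [hPm] at h35m
  have hodd : Odd (D.scriptL m) := PrimeBlockDigits.odd_scriptL_right h12 hl hm hm8 hn D hPr.1
  have hL0 : u * D.scriptL m ≠ 0 := by
    refine mul_ne_zero ?_ (fun h => by simp [h] at hodd)
    rcases hu with rfl | rfl <;> norm_num
  have hαmnt' : ¬ IsOfFinAddOrder (Point.map (W' := curveA) (D.embK m hmd) αm) :=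
    fun h => hαmnt (LevelTwo.isOfFinAddOrder_of_map (D.embK m hmd) h)
  apply hαmnt'
  have h3 : IsOfFinAddOrder ((u * D.scriptL m) • Point.map (W' := curveA) (D.embK m hmd) αm) := by
    have e : (u * D.scriptL m) • Point.map (W' := curveA) (D.embK m hmd) αm =
        (2 : ℤ) • D.Z m + -((2 : ℤ) • D.Z m - (u * D.scriptL m) • Point.map (W' := curveA) (D.embK m hmd) αm) := by abel
    rw [e]
    exact hZ.zsmul.add h35m.neg
  exact LevelTwo.isOfFinAddOrder_of_zsmul hL0 h3

end Main

end Summit.BirchSwinnertonDyer.PrintCf2.GenusPeriodNonTorsion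

end
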